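import Summits.ValiantsHypothesis.ValiantsHypothesis.Theorems.LacunarySymmetroidMatrixDescartesFiniteSectorStampCeilingKThreeAll
import Summits.ValiantsHypothesis.ValiantsHypothesis.Theorems.LacunarySymmetroidMatrixDescartesFiniteSectorLadderThree
import Summits.ValiantsHypothesis.ValiantsHypothesis.Theorems.LacunarySymmetroidMatrixDescartesFiniteSectorLadderTwo
import Summits.ValiantsHypothesis.ValiantsHypothesis.Theorems.LacunarySymmetroidMatrixDescartesFiniteSectorRankOneRung

/-!
# `MatrixDescartes` — line «finite» / «stamp»: the LADDER CEILING on a fixed support `(0,1,d)` and the three EXACT columns: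
# every full-positive-rooted `(0,1,d)` pencil of size `m` has degree `≤ d(m+3−d) − 2` (`1 ≤ d ≤ m+2`); on `(0,1,2)`, `(0,1,3)` and
# `(0,1,m+1)` the values `2m`, `3m − 2`, `2m` are attained AND maximal for every `m`

HONEST FRAMING.  Object-search cell `pub-symmetroid`, seat val-sym-eng-3 g11 (census/instrument ENGINE #3 of D-0148 (b)).
HELPER of the crux item `stmt-ValiantsHypothesis-18050`
(`Summit.ValiantsHypothesis.ValiantsHypothesis.Theses.LacunarySymmetroid.MatrixDescartes`, asymptotic in `K`) with NO closure
claim.  Instrument/structure tier.  The cell's located «ladder» programme (val-sym-eng-3 g6–g9, memos `LADDER-017/018`; rank-one rung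
for all `m`: `…FiniteSectorRankOneRung`, g10) climbs, for a FIXED basis `(0,1,d)`, the rungs `m = d−1, d, d+1, …` with the target
degree `n = d(m+3−d) − 2` (`+d` per rung).  This file records in the kernel, for all `m` and `d` at once, that this target is the
CEILING of the support (`natDegree_le_ladder`): by T3 of line «finite» (`mem_sumset_of_fullPos`: every `r ≤ deg` is an `m`-fold sum
of exponents) and Stöhr's witness (`stoehr_witness_not_rep`: `d(m+3−d) − 1` is not `p + q·d` with `p + q ≤ m`), a
full-positive-rooted determinant on `(0,1,d)` (`1 ≤ d ≤ m + 2`, any size `m ≥ 1`, symmetry not needed) has degree `≤ d(m+3−d) − 2`.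
With the all-`m` witnesses of `…FiniteSectorLadderThree` (`fullyRealisable_ladder013`, the arrow design), `…FiniteSectorLadderTwo`
(`fullyRealisable_ladder012`, diagonal) and `…FiniteSectorRankOneRung` (`fullyRealisable_rankOneRung`, g10) three fixed-support columns
of the `K = 3` stamp table are therefore EXACT for every `m ≥ 1` on both sides in the kernel: `ladder012_exact` (`2m`),
`ladder013_exact` (`3m − 2`), `rankOneRung_exact` (`(0,1,m+1) ↦ 2m`).  Nothing here bears on the crux (asymptotic in `K`) or on
`VP ≠ VNP`.
[folklore] Postage-stamp bookkeeping (two denominations); no citation is load-bearing.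
-/

-- `Summit.ValiantsHypothesis.ValiantsHypothesis.…` repeats a component by the D-0017 layout
-- (single-conjunct summit), which the `dupNamespace` linter flags; the name is mandated.
set_option linter.dupNamespace false

namespace Summit.ValiantsHypothesis.ValiantsHypothesis.Theorems.LacunarySymmetroidMatrixDescartes.FiniteSector

open scoped BigOperators Matrix
open Polynomial

/-- **LADDER CEILING (kernel, all sizes and all bases).**  On the support `(0, 1, d)` with `1 ≤ d ≤ m + 2`, every
full-positive-rooted determinant of an `m × m` half-pencil (symmetric or not) has degree `≤ d(m + 3 − d) − 2` — the target degree of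
rung `m` of the `(0,1,d)` ladder is the most the support allows.  (`d ≥ m + 3`: the bound is `m`, by `not_rep_of_large`; not
recorded here.) [folklore] -/
theorem natDegree_le_ladder {m : ℕ} (hm : 1 ≤ m) (d : ℕ) (hd1 : 1 ≤ d) (hdm : d ≤ m + 2)
    (S : Fin 3 → Matrix (Fin m) (Fin m) ℝ) (hfull : IsFullPosRooted (pencil (![0, 1, d] : Fin 3 → ℕ) S).det) :
    (pencil (![0, 1, d] : Fin 3 → ℕ) S).det.natDegree ≤ d * (m + 3 - d) - 2 := by
  by_contra hdeg'
  have hdeg : d * (m + 3 - d) - 1 ≤ (pencil (![0, 1, d] : Fin 3 → ℕ) S).det.natDegree := by omega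
  -- the target `r = d(m+3-d) - 1` is at least `2`, so the determinant is not the zero polynomial
  obtain ⟨e, he⟩ : ∃ e, m + 3 - d = e + 1 := ⟨m + 2 - d, by omega⟩
  have hr2 : 2 ≤ d * (m + 3 - d) - 1 := by
    rw [he]
    obtain ⟨d', rfl⟩ : ∃ d', d = d' + 1 := ⟨d - 1, by omega⟩
    have : 3 ≤ (d' + 1) * (e + 1) := by nlinarith [Nat.zero_le (d' * e), show 2 ≤ d' + e by omega]
    omega
  have hq : (pencil (![0, 1, d] : Fin 3 → ℕ) S).det ≠ 0 := by
    intro h0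
    rw [h0, Polynomial.natDegree_zero] at hdeg
    omega
  -- every `r ≤ deg` is an `m`-fold sum of the exponents `0, 1, d`
  have h := mem_sumset_of_fullPos (![0, 1, d] : Fin 3 → ℕ) S hq hfull hdeg
  rw [Finset.mem_image] at h
  obtain ⟨s, -, hs⟩ := h
  have hvals : ∀ i : Fin 3, (![0, 1, d] : Fin 3 → ℕ) i = 0 ∨ (![0, 1, d] : Fin 3 → ℕ) i = 1 ∨
      (![0, 1, d] : Fin 3 → ℕ) i = d := by
    intro i
    fin_cases i <;> simp
  set sm : Multiset (Fin 3) := (s : Multiset (Fin 3)) with hsm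
  have hcard : Multiset.card sm = m := s.2
  obtain ⟨p, q, hpq, hsum⟩ := sum_eq_stamps (![0, 1, d] : Fin 3 → ℕ) d hvals sm
  rw [hcard] at hpq
  rw [hsum] at hs
  exact stoehr_witness_not_rep m d hd1 hdm p q hpq hs

/-- The `(0,1,3)` case for every `m ≥ 1`: a full-positive-rooted `(0,1,3)` determinant of size `m` has degree `≤ 3m − 2`. [folklore] -/
theorem natDegree_le_ladder013 {m : ℕ} (hm : 1 ≤ m) (S : Fin 3 → Matrix (Fin m) (Fin m) ℝ)
    (hfull : IsFullPosRooted (pencil (![0, 1, 3] : Fin 3 → ℕ) S).det) :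
    (pencil (![0, 1, 3] : Fin 3 → ℕ) S).det.natDegree ≤ 3 * m - 2 := by
  have h := natDegree_le_ladder hm 3 (by norm_num) (by omega) S hfull
  have : 3 * (m + 3 - 3) - 2 = 3 * m - 2 := by omega
  omega

/-- **THE `(0,1,3)` LADDER IS EXACT AT EVERY RUNG (kernel, all `m ≥ 1`).**  On the support `(0,1,3)` at size `m`, the degree
`3m − 2` is realised by a symmetric half-pencil with full-positive-rooted determinant (`fullyRealisable_ladder013`, the arrow
design) and no full-positive-rooted determinant has larger degree (`natDegree_le_ladder013`). [folklore] -/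
theorem ladder013_exact (m : ℕ) (hm : 1 ≤ m) :
    FullyRealisable m (![0, 1, 3] : Fin 3 → ℕ) (3 * m - 2) ∧
      ∀ S : Fin 3 → Matrix (Fin m) (Fin m) ℝ, IsFullPosRooted (pencil (![0, 1, 3] : Fin 3 → ℕ) S).det →
        (pencil (![0, 1, 3] : Fin 3 → ℕ) S).det.natDegree ≤ 3 * m - 2 :=
  ⟨fullyRealisable_ladder013 m hm, fun S hS => natDegree_le_ladder013 hm S hS⟩

/-- No rung overshoots: `FullyRealisable m ![0,1,3] n → n ≤ 3m − 2` (`m ≥ 1`). [folklore] -/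
theorem le_of_fullyRealisable_013 {m n : ℕ} (hm : 1 ≤ m) (h : FullyRealisable m (![0, 1, 3] : Fin 3 → ℕ) n) :
    n ≤ 3 * m - 2 := by
  obtain ⟨S, -, hfull, hdeg⟩ := h
  have := natDegree_le_ladder013 hm S hfull
  omega


/-- **THE `(0,1,2)` COLUMN IS EXACT (kernel, all `m ≥ 1`)**: `2m` is realised (`fullyRealisable_ladder012`, diagonal pencil) and is
the ceiling of the support (`natDegree_le_ladder` with `d = 2`). [folklore] -/
theorem ladder012_exact (m : ℕ) (hm : 1 ≤ m) :
    FullyRealisable m (![0, 1, 2] : Fin 3 → ℕ) (2 * m) ∧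
      ∀ S : Fin 3 → Matrix (Fin m) (Fin m) ℝ, IsFullPosRooted (pencil (![0, 1, 2] : Fin 3 → ℕ) S).det →
        (pencil (![0, 1, 2] : Fin 3 → ℕ) S).det.natDegree ≤ 2 * m := by
  refine ⟨fullyRealisable_ladder012 m, fun S hS => ?_⟩
  have h := natDegree_le_ladder hm 2 (by norm_num) (by omega) S hS
  have : 2 * (m + 3 - 2) - 2 = 2 * m := by omega
  omega

/-- **THE RANK-ONE COLUMN `(0,1,m+1)` IS EXACT (kernel, all `m ≥ 1`)**: `2m` is realised (`fullyRealisable_rankOneRung`, g10's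
diagonal-plus-rank-one design) and is the ceiling of the support (`natDegree_le_ladder` with `d = m + 1`). [folklore] -/
theorem rankOneRung_exact (m : ℕ) (hm : 1 ≤ m) :
    FullyRealisable m (![0, 1, m + 1] : Fin 3 → ℕ) (2 * m) ∧
      ∀ S : Fin 3 → Matrix (Fin m) (Fin m) ℝ, IsFullPosRooted (pencil (![0, 1, m + 1] : Fin 3 → ℕ) S).det →
        (pencil (![0, 1, m + 1] : Fin 3 → ℕ) S).det.natDegree ≤ 2 * m := by
  refine ⟨fullyRealisable_rankOneRung m, fun S hS => ?_⟩
  have h := natDegree_le_ladder hm (m + 1) (by omega) (by omega) S hS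
  have : (m + 1) * (m + 3 - (m + 1)) - 2 = 2 * m := by
    rw [show m + 3 - (m + 1) = 2 by omega]; omega
  omega

end Summit.ValiantsHypothesis.ValiantsHypothesis.Theorems.LacunarySymmetroidMatrixDescartes.FiniteSector
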